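import Summits.AtomisticToContinuum.Crystallization.Theorems.ExcessDecayLiouvilleHcpLiouvilleBlowdownLinRows
import Summits.AtomisticToContinuum.Crystallization.Theorems.ExcessDecayLiouvilleTranslation

/-!
# `ExcessDecayLiouville.HcpLiouville` (stmt-AtomisticToContinuum-9332), line `Sketch` (skeleton v4): localisation of an `L`-harmonic field

Helper for stub `stub_interior` (steps (1)–(2) of the interior estimate for `L`-harmonic fields): on the sites
`S = Sites₀ t A` of an admissible hcp-like datum, a field `z` that is `L`-harmonic on `B_R(c)`
(`Blowdown.IsHarmonicOn`, full rows) is localised with a sharp indicator, `ẑ = 𝟙_{B_{R'}(c)}·(z − m)`; the rows of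
the force-constant operator on `ẑ` are then the FAR FIELD `f(p) = Σ'_{q ∉ B_{R'}} K(p − q)(z q − m)`
(`Blowdown.hasSum_row_localise`), rows commute with lattice translations (`Blowdown.hasSum_row_translate`, reindexing
by `exists_sitesShift`) and are linear in the field, so the lattice differences `D_l F = F(· + A l) − F` of a field with
row function `g` on `B_ρ(c)` have row function `D_l g` on `B_{ρ−2}(c)` (`Blowdown.rows_diff`, `‖A l‖ ≤ 2`), and the
differences of the far field fall on the first argument of the kernel (`Blowdown.farField_diff₁/diff₂`).  Also: the
summability of the far family (`Blowdown.summable_farField`) and the elementary pointwise bounds it needs.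
All `[folklore]`; a `--supports` helper for item stmt-AtomisticToContinuum-9332, nothing here closes an item.
-/

noncomputable section

namespace Summit.AtomisticToContinuum.Crystallization.Theorems.ExcessDecayLiouville

open scoped BigOperators Topology Classical InnerProductSpace RealInnerProductSpace
open Literature.MathematicalPhysics.StatisticalMechanics
open Summit.AtomisticToContinuum.Crystallization.Theses.ExcessDecayLiouville
open Summit.AtomisticToContinuum.Crystallization.Theorems.PhononStabilityNegative

namespace Blowdown

open LevelOne

variable {t : Fin 2 → (EuclideanSpace ℝ (Fin 3))}
  {A : (EuclideanSpace ℝ (Fin 3)) →L[ℝ] (EuclideanSpace ℝ (Fin 3))}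

/-! ## Rows commute with lattice translations and are linear in the field -/

/-- **Rows commute with lattice translations**: if the row of `F` at the site `p + A l` has sum `g`, then the row
at `p` of the translate `F(· + A l)` has sum `g` (reindex the row by `q ↦ q + A l`). [folklore] -/
theorem hasSum_row_translate {F : EuclideanSpace ℝ (Fin 3) → EuclideanSpace ℝ (Fin 3)}
    {l : EuclideanSpace ℝ (Fin 3)} (hl : l ∈ Λ₀) (p : Sites₀ t A) {g : EuclideanSpace ℝ (Fin 3)}
    (h : HasSum (fun q : Sites₀ t A =>
      forceConst ((p : EuclideanSpace ℝ (Fin 3)) + A l - q) (F ((p : EuclideanSpace ℝ (Fin 3)) + A l) - F q)) g) :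
    HasSum (fun q : Sites₀ t A => forceConst ((p : EuclideanSpace ℝ (Fin 3)) - q)
      (F ((p : EuclideanSpace ℝ (Fin 3)) + A l) - F ((q : EuclideanSpace ℝ (Fin 3)) + A l))) g := by
  obtain ⟨e, he⟩ := exists_sitesShift (t := t) (A := A) hl
  have hfun : (fun q : Sites₀ t A => forceConst ((p : EuclideanSpace ℝ (Fin 3)) - q)
      (F ((p : EuclideanSpace ℝ (Fin 3)) + A l) - F ((q : EuclideanSpace ℝ (Fin 3)) + A l))) =
      (fun q : Sites₀ t A => forceConst ((p : EuclideanSpace ℝ (Fin 3)) + A l - q)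
        (F ((p : EuclideanSpace ℝ (Fin 3)) + A l) - F q)) ∘ e := by
    funext q
    simp only [Function.comp_apply, he q]
    congr 2
    abel
  rw [hfun]
  exact e.hasSum_iff.2 h

/-- **Rows are linear in the field**: the row of `F − G` is the difference of the rows. [folklore] -/
theorem hasSum_row_sub {F G : EuclideanSpace ℝ (Fin 3) → EuclideanSpace ℝ (Fin 3)} (p : Sites₀ t A)
    {g g' : EuclideanSpace ℝ (Fin 3)}
    (hF : HasSum (fun q : Sites₀ t A => forceConst ((p : EuclideanSpace ℝ (Fin 3)) - q) (F p - F q)) g)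
    (hG : HasSum (fun q : Sites₀ t A => forceConst ((p : EuclideanSpace ℝ (Fin 3)) - q) (G p - G q)) g') :
    HasSum (fun q : Sites₀ t A => forceConst ((p : EuclideanSpace ℝ (Fin 3)) - q)
      ((F p - G p) - (F q - G q))) (g - g') := by
  convert hF.sub hG using 1
  funext q
  rw [← map_sub]
  congr 1
  abel

/-- **Rows of a lattice difference**: `D_l F = F(· + A l) − F` has, at the site `p`, the row sum
`g₁ − g₀` where `g₁` is the row sum of `F` at `p + A l` and `g₀` the one at `p`. [folklore] -/
theorem hasSum_row_diff {F : EuclideanSpace ℝ (Fin 3) → EuclideanSpace ℝ (Fin 3)}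
    {l : EuclideanSpace ℝ (Fin 3)} (hl : l ∈ Λ₀) (p : Sites₀ t A) {g₁ g₀ : EuclideanSpace ℝ (Fin 3)}
    (h₁ : HasSum (fun q : Sites₀ t A =>
      forceConst ((p : EuclideanSpace ℝ (Fin 3)) + A l - q) (F ((p : EuclideanSpace ℝ (Fin 3)) + A l) - F q)) g₁)
    (h₀ : HasSum (fun q : Sites₀ t A => forceConst ((p : EuclideanSpace ℝ (Fin 3)) - q) (F p - F q)) g₀) :
    HasSum (fun q : Sites₀ t A => forceConst ((p : EuclideanSpace ℝ (Fin 3)) - q)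
      ((F ((p : EuclideanSpace ℝ (Fin 3)) + A l) - F p) -
        (F ((q : EuclideanSpace ℝ (Fin 3)) + A l) - F q))) (g₁ - g₀) :=
  hasSum_row_sub (F := fun x => F (x + A l)) (G := F) p (hasSum_row_translate hl p h₁) h₀

/-- **Row functions of lattice differences on balls**: if `F` has row function `g` on the sites of `B_ρ(c)` and
`‖A l‖ ≤ 2`, then `D_l F` has row function `D_l g` on the sites of `B_{ρ−2}(c)`. [folklore] -/
theorem rows_diff {F g : EuclideanSpace ℝ (Fin 3) → EuclideanSpace ℝ (Fin 3)} {c : EuclideanSpace ℝ (Fin 3)}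
    {ρ : ℝ} {l : EuclideanSpace ℝ (Fin 3)} (hl : l ∈ Λ₀) (hAl : ‖A l‖ ≤ 2)
    (h : ∀ p : Sites₀ t A, dist (p : EuclideanSpace ℝ (Fin 3)) c ≤ ρ →
      HasSum (fun q : Sites₀ t A => forceConst ((p : EuclideanSpace ℝ (Fin 3)) - q) (F p - F q)) (g p)) :
    ∀ p : Sites₀ t A, dist (p : EuclideanSpace ℝ (Fin 3)) c ≤ ρ - 2 →
      HasSum (fun q : Sites₀ t A => forceConst ((p : EuclideanSpace ℝ (Fin 3)) - q)
        ((F ((p : EuclideanSpace ℝ (Fin 3)) + A l) - F p) - (F ((q : EuclideanSpace ℝ (Fin 3)) + A l) - F q)))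
        (g ((p : EuclideanSpace ℝ (Fin 3)) + A l) - g p) := by
  intro p hp
  set p' : Sites₀ t A := ⟨(p : EuclideanSpace ℝ (Fin 3)) + A l, add_mem_sites₀ p.2 hl⟩ with hp'
  have hd : dist ((p' : Sites₀ t A) : EuclideanSpace ℝ (Fin 3)) c ≤ ρ := by
    have h1 : dist ((p : EuclideanSpace ℝ (Fin 3)) + A l) p = ‖A l‖ := by rw [dist_eq_norm, add_sub_cancel_left]
    have h2 := dist_triangle ((p : EuclideanSpace ℝ (Fin 3)) + A l) p c
    show dist ((p : EuclideanSpace ℝ (Fin 3)) + A l) c ≤ ρ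
    linarith
  exact hasSum_row_diff hl p (h p' hd) (h p (by linarith))

/-! ## The far field of the localised field -/

/-- Pointwise: `‖z q − m‖ ≤ Y₀ + ‖b q‖` when `‖z q − m − b q‖ ≤ Y₀`. [folklore] -/
theorem norm_sub_le_of_decomp {z b : EuclideanSpace ℝ (Fin 3) → EuclideanSpace ℝ (Fin 3)}
    {m : EuclideanSpace ℝ (Fin 3)} {Y₀ : ℝ} {q : EuclideanSpace ℝ (Fin 3)} (h : ‖z q - m - b q‖ ≤ Y₀) :
    ‖z q - m‖ ≤ Y₀ + ‖b q‖ := by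
  have := norm_add_le (z q - m - b q) (b q)
  rw [sub_add_cancel] at this
  linarith

/-- A single term of a nonnegative summable family is bounded by the `tsum`; for the square-summable part `b`:
`‖b q‖ ≤ Y₂`. [folklore] -/
theorem norm_le_of_tsum_sq_le {b : EuclideanSpace ℝ (Fin 3) → EuclideanSpace ℝ (Fin 3)} {Y₂ : ℝ} (hY₂ : 0 ≤ Y₂)
    (hb : Summable fun p : Sites₀ t A => ‖b p‖ ^ 2) (hb2 : ∑' p : Sites₀ t A, ‖b p‖ ^ 2 ≤ Y₂ ^ 2)
    (q : Sites₀ t A) : ‖b q‖ ≤ Y₂ := by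
  have h1 : ‖b q‖ ^ 2 ≤ ∑' p : Sites₀ t A, ‖b p‖ ^ 2 :=
    hb.le_tsum q fun p _ => sq_nonneg _
  exact (pow_le_pow_iff_left₀ (norm_nonneg _) hY₂ two_ne_zero).1 (h1.trans hb2)

/-- **Summability of the far family**: for a site `y` and a field with `‖z q − m‖ ≤ Ȳ` on the sites, the family
`q ↦ 𝟙[q ∉ B_{R'}]·K(y − q)(z q − m)` is summable (`‖K(y − q)‖ ≤ k(y,q)`, row-summable kernel). [folklore] -/
theorem summable_farField (hA : Adm₀ A) (hI : Inner₀ t A) {z : EuclideanSpace ℝ (Fin 3) → EuclideanSpace ℝ (Fin 3)}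
    {c m : EuclideanSpace ℝ (Fin 3)} {R' Ybar : ℝ} (hY : ∀ q ∈ Sites₀ t A, ‖z q - m‖ ≤ Ybar)
    {y : EuclideanSpace ℝ (Fin 3)} (hy : y ∈ Sites₀ t A) :
    Summable fun q : Sites₀ t A =>
      if dist (q : EuclideanSpace ℝ (Fin 3)) c ≤ R' then (0 : EuclideanSpace ℝ (Fin 3))
      else forceConst (y - q) (z q - m) := by
  have hY0 : 0 ≤ Ybar := by
    obtain ⟨m₀, z₀, hz₀, rfl⟩ := hy
    exact (norm_nonneg _).trans (hY _ ⟨m₀, z₀, hz₀, rfl⟩)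
  refine Summable.of_norm_bounded ((summable_ker hA hI hy).mul_right Ybar) fun q => ?_
  split_ifs
  · rw [norm_zero]; exact mul_nonneg (ker_nonneg _ _) hY0
  · exact (norm_forceConst_apply_le_ker hA hI hy q.2 _).trans
      (mul_le_mul_of_nonneg_left (hY q q.2) (ker_nonneg _ _))

/-- **Rows of the localised field are the far field**: for `ẑ = 𝟙_{B_{R'}(c)}(z − m)` and a site `p ∈ B_{R'}(c) ∩ B_R(c)`
where `z` is `L`-harmonic, `Σ_q K(p − q)(ẑ p − ẑ q) = Σ'_{q ∉ B_{R'}} K(p − q)(z q − m)` (`HasSum`): the full row of `z`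
vanishes and rows kill constants. [folklore] -/
theorem hasSum_row_localise (hA : Adm₀ A) (hI : Inner₀ t A)
    {z zh : EuclideanSpace ℝ (Fin 3) → EuclideanSpace ℝ (Fin 3)} {c m : EuclideanSpace ℝ (Fin 3)} {R R' Ybar : ℝ}
    (hY : ∀ q ∈ Sites₀ t A, ‖z q - m‖ ≤ Ybar) (hz : IsHarmonicOn (Sites₀ t A) z c R)
    (hzh : ∀ x, zh x = if dist x c ≤ R' then z x - m else 0)
    (p : Sites₀ t A) (hp : dist (p : EuclideanSpace ℝ (Fin 3)) c ≤ R') (hpR : dist (p : EuclideanSpace ℝ (Fin 3)) c ≤ R) :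
    HasSum (fun q : Sites₀ t A => forceConst ((p : EuclideanSpace ℝ (Fin 3)) - q) (zh p - zh q))
      (∑' q : Sites₀ t A, if dist (q : EuclideanSpace ℝ (Fin 3)) c ≤ R' then (0 : EuclideanSpace ℝ (Fin 3))
        else forceConst ((p : EuclideanSpace ℝ (Fin 3)) - q) (z q - m)) := by
  have hrow := hz p hpR
  have hfar := summable_farField hA hI (c := c) (R' := R') hY p.2
  have key : ∀ q : Sites₀ t A, forceConst ((p : EuclideanSpace ℝ (Fin 3)) - q) (zh p - zh q) =
      forceConst ((p : EuclideanSpace ℝ (Fin 3)) - q) (z p - z q) +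
        (if dist (q : EuclideanSpace ℝ (Fin 3)) c ≤ R' then (0 : EuclideanSpace ℝ (Fin 3))
          else forceConst ((p : EuclideanSpace ℝ (Fin 3)) - q) (z q - m)) := by
    intro q
    rw [hzh p, if_pos hp, hzh q]
    split_ifs with hq
    · rw [add_zero]; congr 1; abel
    · rw [← map_add]; congr 1; abel
  have := hrow.add hfar.hasSum
  rw [zero_add] at this
  convert this using 1
  funext q
  exact key q

/-- **First differences of the far field fall on the kernel**: for sites `y` and `y + A l`,
`f(y + A l) − f(y) = Σ'_{q ∉ B_{R'}} (K(y − q + A l) − K(y − q))(z q − m)`. [folklore] -/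
theorem farField_diff₁ (hA : Adm₀ A) (hI : Inner₀ t A) {z : EuclideanSpace ℝ (Fin 3) → EuclideanSpace ℝ (Fin 3)}
    {c m : EuclideanSpace ℝ (Fin 3)} {R' Ybar : ℝ} (hY : ∀ q ∈ Sites₀ t A, ‖z q - m‖ ≤ Ybar)
    {y v : EuclideanSpace ℝ (Fin 3)} (hy : y ∈ Sites₀ t A) (hyv : y + v ∈ Sites₀ t A) :
    (∑' q : Sites₀ t A, if dist (q : EuclideanSpace ℝ (Fin 3)) c ≤ R' then (0 : EuclideanSpace ℝ (Fin 3))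
        else forceConst (y + v - q) (z q - m)) -
      (∑' q : Sites₀ t A, if dist (q : EuclideanSpace ℝ (Fin 3)) c ≤ R' then (0 : EuclideanSpace ℝ (Fin 3))
        else forceConst (y - q) (z q - m)) =
      ∑' q : Sites₀ t A, if dist (q : EuclideanSpace ℝ (Fin 3)) c ≤ R' then (0 : EuclideanSpace ℝ (Fin 3))
        else (forceConst (y - q + v) - forceConst (y - q)) (z q - m) := by
  rw [← (summable_farField hA hI (c := c) (R' := R') hY hyv).tsum_sub (summable_farField hA hI hY hy)]
  refine tsum_congr fun q => ?_
  split_ifs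
  · rw [sub_zero]
  · rw [sub_apply]; congr 2; abel

/-- **Second differences of the far field fall on the kernel**: for sites `y, y + A l, y + A l', y + A l' + A l`,
`f(y + Al' + Al) − f(y + Al') − f(y + Al) + f(y) = Σ'_{q ∉ B_{R'}} (Δ_{Al}Δ_{Al'}K)(y − q)(z q − m)`. [folklore] -/
theorem farField_diff₂ (hA : Adm₀ A) (hI : Inner₀ t A) {z : EuclideanSpace ℝ (Fin 3) → EuclideanSpace ℝ (Fin 3)}
    {c m : EuclideanSpace ℝ (Fin 3)} {R' Ybar : ℝ} (hY : ∀ q ∈ Sites₀ t A, ‖z q - m‖ ≤ Ybar)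
    {y v v' : EuclideanSpace ℝ (Fin 3)} (hy : y ∈ Sites₀ t A) (hyv : y + v ∈ Sites₀ t A)
    (hyv' : y + v' ∈ Sites₀ t A) (hyvv : y + v' + v ∈ Sites₀ t A) :
    (∑' q : Sites₀ t A, if dist (q : EuclideanSpace ℝ (Fin 3)) c ≤ R' then (0 : EuclideanSpace ℝ (Fin 3))
        else forceConst (y + v' + v - q) (z q - m)) -
      (∑' q : Sites₀ t A, if dist (q : EuclideanSpace ℝ (Fin 3)) c ≤ R' then (0 : EuclideanSpace ℝ (Fin 3))
        else forceConst (y + v' - q) (z q - m)) -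
      (∑' q : Sites₀ t A, if dist (q : EuclideanSpace ℝ (Fin 3)) c ≤ R' then (0 : EuclideanSpace ℝ (Fin 3))
        else forceConst (y + v - q) (z q - m)) +
      (∑' q : Sites₀ t A, if dist (q : EuclideanSpace ℝ (Fin 3)) c ≤ R' then (0 : EuclideanSpace ℝ (Fin 3))
        else forceConst (y - q) (z q - m)) =
      ∑' q : Sites₀ t A, if dist (q : EuclideanSpace ℝ (Fin 3)) c ≤ R' then (0 : EuclideanSpace ℝ (Fin 3))
        else (forceConst (y - q + v' + v) - forceConst (y - q + v') - forceConst (y - q + v) + forceConst (y - q))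
          (z q - m) := by
  have h1 := summable_farField hA hI (c := c) (R' := R') hY hyvv
  have h2 := summable_farField hA hI (c := c) (R' := R') hY hyv'
  have h3 := summable_farField hA hI (c := c) (R' := R') hY hyv
  have h4 := summable_farField hA hI (c := c) (R' := R') hY hy
  rw [← h1.tsum_sub h2, ← (h1.sub h2).tsum_sub h3, ← ((h1.sub h2).sub h3).tsum_add h4]
  refine tsum_congr fun q => ?_
  split_ifs
  · simp
  · simp only [sub_apply, add_apply]
    have e1 : y + v' + v - (q : EuclideanSpace ℝ (Fin 3)) = y - q + v' + v := by abel
    have e2 : y + v' - (q : EuclideanSpace ℝ (Fin 3)) = y - q + v' := by abel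
    have e3 : y + v - (q : EuclideanSpace ℝ (Fin 3)) = y - q + v := by abel
    rw [e1, e2, e3]

end Blowdown

/-- Registered carrier of this helper file (crux stmt-AtomisticToContinuum-9332, line `Sketch` v4, stub
`stub_interior`, steps (1)–(2)): the rows of the force-constant operator on the lattice difference `F(· + A l) − F` of
a field `F` with row function `g` on the sites of `B_ρ(c)` are `g(· + A l) − g` on the sites of `B_{ρ−2}(c)`
(`l ∈ Λ₀`, `‖A l‖ ≤ 2`). [folklore] -/
theorem blowdown_localise : ∀ (t : Fin 2 → (EuclideanSpace ℝ (Fin 3)))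
    (A : (EuclideanSpace ℝ (Fin 3)) →L[ℝ] (EuclideanSpace ℝ (Fin 3)))
    (F g : (EuclideanSpace ℝ (Fin 3)) → (EuclideanSpace ℝ (Fin 3))) (c l : (EuclideanSpace ℝ (Fin 3))) (ρ : ℝ),
    l ∈ Λ₀ → ‖A l‖ ≤ 2 →
    (∀ p : Sites₀ t A, dist (p : (EuclideanSpace ℝ (Fin 3))) c ≤ ρ →
      HasSum (fun q : Sites₀ t A => forceConst ((p : (EuclideanSpace ℝ (Fin 3))) - q) (F p - F q)) (g p)) →
    ∀ p : Sites₀ t A, dist (p : (EuclideanSpace ℝ (Fin 3))) c ≤ ρ - 2 →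
      HasSum (fun q : Sites₀ t A => forceConst ((p : (EuclideanSpace ℝ (Fin 3))) - q)
        ((F ((p : (EuclideanSpace ℝ (Fin 3))) + A l) - F p) - (F ((q : (EuclideanSpace ℝ (Fin 3))) + A l) - F q)))
        (g ((p : (EuclideanSpace ℝ (Fin 3))) + A l) - g p) :=
  fun _ _ _ _ _ _ _ hl hAl h => Blowdown.rows_diff hl hAl h

end Summit.AtomisticToContinuum.Crystallization.Theorems.ExcessDecayLiouville

end
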